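import Summits.BirchSwinnertonDyer.BirchSwinnertonDyer.Theorems.CumulativeHeegnerLeopoldtRedSplitControlAtThreeShaDualAnnihilator
import Literature.NumberTheory.GaloisCohomology.PoitouTateSha
import HarnessLib

/-!
# Poitou–Tate, the annihilator of `Ш¹` — the COUNT `#Ш²(K, M) ≤ #Ш¹(K, M^D)` from a readout of `Ш²` into
# `Hom(H¹(K, M^D), ℤ/n)` modulo sums of local pairings (the typed interface Route A has to supply)

Cell `bsd-wall`, seat `bsd-line-chl-p2` g5 (crux K4 stmt-BirchSwinnertonDyer-24200, stub
`stub_poitouTateShaTateDual` = `poitouTate_sha_tateDual`, item 20462).  Part 3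
(`…ShaDualAnnihilator`, `exists_family_sum_localTatePairing_eq_of_isTotallyComplex`) proved: for a family
`inv` with `IsPerfect ∧ UnramifiedOrthogonal ∧ SelmerComplement` over a totally complex `K`, every additive
`φ : H¹(K, M^D) → ℤ/n` vanishing on `Ш¹(K, M^D)` is a SUM OF LOCAL PAIRINGS `y ↦ ∑_v inv_v(t_v ∪ y_v)` against
one `t ∈ P¹(K, M)`.  This file isolates, as displayed hypotheses on existing objects, exactly what the idèle-class
route (cell `bsd-schneider`, Route A: `0 → K̄ˣ → J̄ → C̄ → 0`, Tate's `α¹` for `C̄`, the readout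
`Ext¹(M^D, J̄) = P¹(K, M)`) has to deliver for the inequality that crux K4 consumes
(`#Ш²(K, E[3^k]) ≤ #Ш¹(K, E[3^k]^D)`, weak-Leopoldt atom `SchneiderFreeAdditiveX3AnticycControlAdditiveH2AnyTorsion`):

  a READOUT `e : Ш²(K, M) → Hom(H¹(K, M^D), ℤ/n)` (any set-theoretic choice of representatives of
  `Ш²(K, M) ≅ Ext¹(M^D, C̄)/Im Ext¹(M^D, J̄) —α¹→ H¹(K, M^D)^*/γ¹(P¹(K, M))`) which is
  (add) ADDITIVE MODULO SUMS OF LOCAL PAIRINGS and (inj) INJECTIVE MODULO SUMS OF LOCAL PAIRINGS against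
  families `t` vanishing at the infinite places and unramified off a finite set.

**`natCard_shaTwo_le_of_readout`**: given such an `e`, `Ш²(K, M)` is finite and `#Ш²(K, M) ≤ #Ш¹(K, M^D)`.
Proof: `c ↦ e(c)|_{Ш¹(K, M^D)}` is additive (local sums kill `Ш¹`) and injective (a readout vanishing on `Ш¹` is
a local sum by part 3, hence `c = 0` by (inj)); `#Hom(Ш¹(K, M^D), ℤ/n) = #Ш¹(K, M^D)`.  Theorems only; the
hypotheses (add)/(inj) are NOT discharged here (that is Route A's degree-`2` dictionary); closes no item; BSD is
not proved by any of this.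

References: [MilneADT2006] I Thm. 4.10 (a)(b) and proof, §0 Prop. 0.19; [Harari2020] Thm. 17.13 (b).
-/

noncomputable section

open Function NumberField IsDedekindDomain
open scoped NumberField

universe u

set_option linter.dupNamespace false
set_option autoImplicit false

namespace Summit.BirchSwinnertonDyer.BirchSwinnertonDyer.Theorems.PoitouTateShaAnnihilator

open Literature.NumberTheory.GaloisRepresentations
open Literature.NumberTheory.GaloisRepresentations.DiscreteGaloisModule (mu localTatePairingZMod tateDual
  unramifiedSubgroup SelmerStructure sha shaTwo)
open Literature.NumberTheory.GaloisCohomology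

variable {K : Type u} [Field K] [NumberField K] {M : Type u} [AddCommGroup M] [TopologicalSpace M]
  [DiscreteTopology M] [Finite M] {n : ℕ} [NeZero n]

/-- **`#Ш²(K, M) ≤ #Ш¹(K, M^D)` from a readout of `Ш²` modulo sums of local pairings** (the counting half of
Milne I Thm. 4.10 (a), assembled from part 3 and the displayed Route-A interface).  `K` totally complex; `inv`
with `IsPerfect`, `UnramifiedOrthogonal`, `SelmerComplement`; `M` finite `n`-torsion, unramified off the finite
`S₀ ⊇ {v ∣ ∞} ∪ {v ∣ n}`; `Ш¹(K, M^D)` finite.  HYPOTHESES ON THE READOUT `e : Ш²(K, M) → Hom(H¹(K, M^D), ℤ/n)`: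
(add) for all `c, c'` the functional `e(c + c') − e(c) − e(c')` is, on the classes unramified off some finite
`S₁`, the sum `∑_{v ∈ S} inv_v(t_v ∪ y_v)` for one family `t` (every finite `S ⊇ S₁` off which `y` is
unramified); (inj) if `e(c)` is such a sum for a family `t` vanishing at the infinite places and unramified off
`S₁ ⊇ S₀`, then `c = 0`.  CONCLUSION: `Ш²(K, M)` is finite and `#Ш²(K, M) ≤ #Ш¹(K, M^D)`.
[cite: MilneADT2006, Ch. I, Thm. 4.10 (a) and proof, §0 Prop. 0.19] [cite: Harari2020, Thm. 17.13 (b)] -/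
theorem natCard_shaTwo_le_of_readout [IsTotallyComplex K]
    {inv : LocalInvariants K n} (hperf : inv.IsPerfect)
    (hur : inv.UnramifiedOrthogonal) (hcomp : inv.SelmerComplement)
    (ρ : DiscreteGaloisModule K M) (hM : ∀ m : M, n • m = 0)
    (S₀ : Finset (Place K)) (hinf : ∀ w : InfinitePlace K, (Sum.inl w : Place K) ∈ S₀)
    (hS₀ : ∀ v : HeightOneSpectrum (𝓞 K), (Sum.inr v : Place K) ∉ S₀ →
      ((n : ℕ) : 𝓞 K) ∉ v.asIdeal ∧ GaloisRep.IsUnramifiedAt v ρ)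
    [Finite (sha (ρ.tateDual n))]
    (e : shaTwo ρ → (galoisCohomology (ρ.tateDual n) 1 →+ ZMod n))
    (hadd : ∀ c c' : shaTwo ρ, ∃ (S₁ : Finset (Place K)) (t : Π v : Place K, galoisCohomology (ρ.toLocal v) 1),
      ∀ (y : galoisCohomology (ρ.tateDual n) 1) (S : Finset (Place K)), S₁ ⊆ S →
        (∀ v : HeightOneSpectrum (𝓞 K), (Sum.inr v : Place K) ∉ S →
          galoisCohomology.localization (ρ.tateDual n) (Sum.inr v) 1 y ∈
            unramifiedSubgroup (GaloisRep.toLocal v (ρ.tateDual n)) 1) →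
        (e (c + c') - e c - e c') y = ∑ v ∈ S, localTatePairingZMod ρ n v (inv v) (t v)
          (galoisCohomology.localization (ρ.tateDual n) v 1 y))
    (hinj : ∀ c : shaTwo ρ, (∃ (S₁ : Finset (Place K)) (t : Π v : Place K, galoisCohomology (ρ.toLocal v) 1),
      S₀ ⊆ S₁ ∧ (∀ w : InfinitePlace K, t (Sum.inl w) = 0) ∧
      (∀ v : HeightOneSpectrum (𝓞 K), (Sum.inr v : Place K) ∉ S₁ →
        t (Sum.inr v) ∈ unramifiedSubgroup (GaloisRep.toLocal v ρ) 1) ∧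
      ∀ (y : galoisCohomology (ρ.tateDual n) 1) (S : Finset (Place K)), S₁ ⊆ S →
        (∀ v : HeightOneSpectrum (𝓞 K), (Sum.inr v : Place K) ∉ S →
          galoisCohomology.localization (ρ.tateDual n) (Sum.inr v) 1 y ∈
            unramifiedSubgroup (GaloisRep.toLocal v (ρ.tateDual n)) 1) →
        e c y = ∑ v ∈ S, localTatePairingZMod ρ n v (inv v) (t v)
          (galoisCohomology.localization (ρ.tateDual n) v 1 y)) → c = 0) :
    Finite (shaTwo ρ) ∧ Nat.card (shaTwo ρ) ≤ Nat.card (sha (ρ.tateDual n)) := by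
  classical
  -- a local sum vanishes on `Ш¹(K, M^D)` (every localisation of such a class is zero)
  have hsha_loc : ∀ y : sha (ρ.tateDual n), ∀ v : Place K,
      galoisCohomology.localization (ρ.tateDual n) v 1 (y : galoisCohomology (ρ.tateDual n) 1) = 0 :=
    fun y v => (DiscreteGaloisModule.mem_sha_iff _ _).1 y.2 v
  have hlocal0 : ∀ (S : Finset (Place K)) (t : Π v : Place K, galoisCohomology (ρ.toLocal v) 1)
      (y : sha (ρ.tateDual n)),
      ∑ v ∈ S, localTatePairingZMod ρ n v (inv v) (t v)
        (galoisCohomology.localization (ρ.tateDual n) v 1 (y : galoisCohomology (ρ.tateDual n) 1)) = 0 :=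
    fun S t y => Finset.sum_eq_zero fun v _ => by rw [hsha_loc y v, map_zero]
  -- the restriction `R : Ш²(K, M) →+ Hom(Ш¹(K, M^D), ℤ/n)`
  have hR_add : ∀ c c' : shaTwo ρ, (e (c + c')).comp (sha (ρ.tateDual n)).subtype =
      (e c).comp (sha (ρ.tateDual n)).subtype + (e c').comp (sha (ρ.tateDual n)).subtype := by
    intro c c'
    obtain ⟨S₁, t, h⟩ := hadd c c'
    ext y
    have hy := h (y : galoisCohomology (ρ.tateDual n) 1) S₁ le_rfl
      (fun v _ => by rw [hsha_loc y (Sum.inr v)]; exact AddSubgroup.zero_mem _)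
    rw [hlocal0] at hy
    simp only [AddMonoidHom.sub_apply] at hy
    simp only [AddMonoidHom.comp_apply, AddSubgroup.coe_subtype, AddMonoidHom.add_apply]
    rw [sub_sub, sub_eq_zero] at hy
    rw [hy]
  let R : shaTwo ρ →+ (sha (ρ.tateDual n) →+ ZMod n) :=
    { toFun := fun c => (e c).comp (sha (ρ.tateDual n)).subtype
      map_zero' := by
        have h := hR_add 0 0
        rw [add_zero] at h
        exact left_eq_add.1 h
      map_add' := hR_add }
  have hR : ∀ c, R c = (e c).comp (sha (ρ.tateDual n)).subtype := fun _ => rfl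
  -- `R` is injective: a readout vanishing on `Ш¹` is a local sum (part 3), hence `c = 0` by (inj)
  have hRinj : Injective R := by
    intro c c' hcc'
    rw [← sub_eq_zero]
    apply hinj
    have h0 : R (c - c') = 0 := by rw [map_sub, hcc', sub_self]
    have hφ : ∀ y ∈ sha (ρ.tateDual n), e (c - c') y = 0 := fun y hy => by
      have := DFunLike.congr_fun h0 ⟨y, hy⟩
      rwa [hR] at this
    exact exists_family_sum_localTatePairing_eq_of_isTotallyComplex hperf hur hcomp ρ hM S₀ hinf hS₀
      (e (c - c')) hφ
  -- count
  have hshaN : ∀ y : sha (ρ.tateDual n), n • y = 0 := fun y => Subtype.ext (by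
    rw [AddSubgroup.coe_nsmul, AddSubgroup.coe_zero]
    exact galoisCohomology.nsmul_eq_zero_of_forall _
      (fun f => DiscreteGaloisModule.TateDual.nsmul_eq_zero f) _)
  haveI : Finite (sha (ρ.tateDual n) →+ ZMod n) := finite_addMonoidHom_zmod _ n
  haveI hfin : Finite (shaTwo ρ) := Finite.of_injective R hRinj
  refine ⟨hfin, ?_⟩
  calc Nat.card (shaTwo ρ) ≤ Nat.card (sha (ρ.tateDual n) →+ ZMod n) := Nat.card_le_card_of_injective R hRinj
    _ = Nat.card (sha (ρ.tateDual n)) := Nat.card_addMonoidHom_zmod hshaN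

end Summit.BirchSwinnertonDyer.BirchSwinnertonDyer.Theorems.PoitouTateShaAnnihilator

end
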